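import Mathlib
import HarnessLib
import Literature.Analysis.FluidPDE.HelicityDensityPseudoscalar
import Summits.NavierStokesRegularity.NavierStokesRegularity.Theorems.UnthreadedDoorAntidynamoWallTwinDichotomy

/-!
# Route `UnthreadedDoor` / `ThreadingFlux`, crux `PoloidalLiouville` (stmt-NavierStokesRegularity-1222), antidynamo v2 skeleton
# (sha16 `4ebf5683127b`), WALL `stub_scalarLiouville`: THE PERIODIC / STEADY / MULTIPLY-SYMMETRIC CORES, EXACTLY

Support file (seat leafhand-ns-unthreadeddoor-2 g1, cell decomp-ns), `--supports stmt-NavierStokesRegularity-1222 --as helper`; theorems only.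

The twin dichotomy (p816196) pins the Galilean gauge of every temporal twin.  Consequences, all for a bounded ancient mild solution (`ν = 1`,
duality class) with measurable slices, jointly smooth on `(−∞,0) × ℝ³` and unthreaded about `x₀`:

* ★★★ `curl_eq_zero_or_periodic_of_curl_periodic` — vorticity `τ`-periodic in time (`τ > 0`) ⇒ EITHER `curl v ≡ 0` on `(−∞,0) × ℝ³` OR the
  VELOCITY ITSELF is exactly `τ`-periodic: `v(t − τ, ·) = v(t, ·)` for every `t < 0` (no drifting gauge `b(t)` survives).
* ★★★ `curl_eq_zero_or_steady_of_curl_steady` — steady vorticity ⇒ EITHER `curl v ≡ 0` OR the velocity is exactly STEADY: `v(s, ·) = v(t, ·)` for all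
  `s, t < 0`.  So the steady residual of the wall is literally the class of bounded smooth steady flows of the duality class, unthreaded about `x₀`
  (the steady stratum the crux ideas «steady-centre-sieve» / «precession-gap» address), with no gauge freedom left.
* ★★★ `curl_eq_zero_or_equivariant_of_curl_symmetric` — vorticity `R`-pseudo-symmetric about `x₀` at every `t < 0` (a linear isometry `R`) ⇒
  EITHER `curl v ≡ 0` OR the VELOCITY ITSELF is exactly `R`-equivariant about `x₀` at all times: `v(t, x₀ + R y) = R v(t, x₀ + y)` — the symmetric
  residual of the wall is exactly the NS-invariant `R`-symmetric class; ★★★ `curl_eq_zero_or_odd_of_curl_even` — the even residual is exactly the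
  centrally symmetric class `v(t, x₀ + x₀ − y) = −v(t, y)`.
* ★★ `curl_eq_zero_or_centre_stagnant_of_two_symmetries` — vorticity pseudo-symmetric about `x₀` under two linear isometries `R₁`, `R₂` with
  `Fix R₁ ∩ Fix R₂ = {0}` (e.g. rotations about two different axes; any irreducible polyhedral symmetry) ⇒ irrotational ∨ `v(t, x₀) = 0` for every
  `t < 0`; the wall's letter `stubScalarLiouville_or_centre_stagnant_of_two_symmetric_potential`.

HONEST LABEL: corollaries of p816196; nothing here proves `stub_scalarLiouville`, `PoloidalLiouville` (1222), or bears on Navier–Stokes regularity;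
no summit statement is proved (crux 1222 is INCOMPARABLE with the summit). [folklore]
[cite: KochNadirashviliSereginSverak2009, Thm 5.2 (arXiv:0709.3599 pp. 9–10)]
-/

noncomputable section

-- the summit and its single sub-problem share the name (CONVENTIONS §1)
set_option linter.dupNamespace false

open scoped Topology InnerProductSpace RealInnerProductSpace ContDiff
open Filter Set Function Metric MeasureTheory
open Literature.Analysis.FluidPDE

namespace Summit.NavierStokesRegularity.NavierStokesRegularity.Theorems.PoloidalLiouville.Antidynamo

open Summit.NavierStokesRegularity.NavierStokesRegularity.Theorems.PoloidalLiouville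
  (constantOfIrrotational)

/-! ### ★★★ Periodic vorticity ⇒ irrotational or exactly periodic velocity -/

/-- ★★★ **PERIODIC VORTICITY ⇒ IRROTATIONAL OR EXACTLY PERIODIC VELOCITY.**  Let `v` be a bounded ancient mild solution (`ν = 1`, duality
class) with measurable slices, jointly smooth on `(−∞,0) × ℝ³` and unthreaded about `x₀`, whose vorticity is `τ`-periodic in time (`τ > 0`):
`curl v(t − τ) = curl v(t)` for all `t < 0`.  Then EITHER `curl v ≡ 0` on `(−∞,0) × ℝ³` OR `v(t − τ, y) = v(t, y)` for all `t < 0`, `y`.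
[Twin dichotomy: the drift `v(t − τ, x₀) − v(t, x₀)` of the temporal twin vanishes at all times, and twins differ exactly by their drift.]
[cite: KochNadirashviliSereginSverak2009, Thm 5.2 (arXiv:0709.3599 pp. 9–10)] -/
theorem curl_eq_zero_or_periodic_of_curl_periodic
    (v : ℝ → EuclideanSpace ℝ (Fin 3) → EuclideanSpace ℝ (Fin 3)) (x₀ : EuclideanSpace ℝ (Fin 3))
    (hB : Literature.Analysis.FluidPDE.IsBoundedAncientMildSolution 1 v)
    (hm : ∀ t < 0, AEStronglyMeasurable (v t) volume)
    (hsm : ContDiffOn ℝ (⊤ : ℕ∞) (Function.uncurry v) (Set.Iio 0 ×ˢ Set.univ))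
    (hun : ∀ t < 0, ∀ x, ⟪x - x₀, curl (v t) x⟫ = 0)
    {τ : ℝ} (hτ : 0 < τ) (hper : ∀ t < 0, ∀ x, curl (v (t - τ)) x = curl (v t) x) :
    (∀ t < 0, ∀ x, curl (v t) x = 0) ∨ ∀ t < 0, ∀ y, v (t - τ) y = v t y := by
  rcases curl_eq_zero_or_centre_periodic_of_curl_periodic v x₀ hB hm hsm hun hτ hper with h | h
  · exact Or.inl h
  · right
    obtain ⟨hBu, -, hsmu⟩ := timeShift_class hB hm hsm (show -τ ≤ 0 by linarith)
    have hsub : ∀ s : ℝ, s + -τ = s - τ := fun s => by ring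
    have hcu : ∀ s < 0, ∀ x, curl ((fun s y => v (s + -τ) y) s) x = curl (v s) x := fun s hs x => by
      show curl (v (s + -τ)) x = curl (v s) x
      rw [hsub]
      exact hper s hs x
    intro t ht y
    have h1 := twin_eq_add_drift x₀ hB hsm hBu hsmu hcu t ht y
    have h2 : v (t - τ) x₀ - v t x₀ = 0 := sub_eq_zero.2 (h t ht)
    simp only [hsub] at h1
    rw [h1, h2, add_zero]

/-- ★★★ **… HENCE: SLICE-WISE CONSTANT OR EXACTLY PERIODIC.** [cite: KochNadirashviliSereginSverak2009, Thm 5.2 (arXiv:0709.3599 pp. 9–10)] -/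
theorem constant_or_periodic_of_curl_periodic
    (v : ℝ → EuclideanSpace ℝ (Fin 3) → EuclideanSpace ℝ (Fin 3)) (x₀ : EuclideanSpace ℝ (Fin 3))
    (hB : Literature.Analysis.FluidPDE.IsBoundedAncientMildSolution 1 v)
    (hm : ∀ t < 0, AEStronglyMeasurable (v t) volume)
    (hsm : ContDiffOn ℝ (⊤ : ℕ∞) (Function.uncurry v) (Set.Iio 0 ×ˢ Set.univ))
    (hun : ∀ t < 0, ∀ x, ⟪x - x₀, curl (v t) x⟫ = 0)
    {τ : ℝ} (hτ : 0 < τ) (hper : ∀ t < 0, ∀ x, curl (v (t - τ)) x = curl (v t) x) :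
    (∀ t < 0, ∃ b : EuclideanSpace ℝ (Fin 3), ∀ x, v t x = b) ∨ ∀ t < 0, ∀ y, v (t - τ) y = v t y := by
  rcases curl_eq_zero_or_periodic_of_curl_periodic v x₀ hB hm hsm hun hτ hper with h | h
  · exact Or.inl (constantOfIrrotational v hB hsm h)
  · exact Or.inr h

/-! ### ★★★ Steady vorticity ⇒ irrotational or exactly steady velocity -/

/-- ★★★ **STEADY VORTICITY ⇒ IRROTATIONAL OR EXACTLY STEADY VELOCITY.**  Under the same hypotheses, if the vorticity is steady
(`curl v(t − τ) = curl v(t)` for all `τ > 0`, `t < 0`), then EITHER `curl v ≡ 0` on `(−∞,0) × ℝ³` OR `v(s, ·) = v(t, ·)` for all `s, t < 0`: the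
steady residual of the wall has no Galilean gauge freedom. [cite: KochNadirashviliSereginSverak2009, Thm 5.2 (arXiv:0709.3599 pp. 9–10)] -/
theorem curl_eq_zero_or_steady_of_curl_steady
    (v : ℝ → EuclideanSpace ℝ (Fin 3) → EuclideanSpace ℝ (Fin 3)) (x₀ : EuclideanSpace ℝ (Fin 3))
    (hB : Literature.Analysis.FluidPDE.IsBoundedAncientMildSolution 1 v)
    (hm : ∀ t < 0, AEStronglyMeasurable (v t) volume)
    (hsm : ContDiffOn ℝ (⊤ : ℕ∞) (Function.uncurry v) (Set.Iio 0 ×ˢ Set.univ))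
    (hun : ∀ t < 0, ∀ x, ⟪x - x₀, curl (v t) x⟫ = 0)
    (hst : ∀ τ : ℝ, 0 < τ → ∀ t < 0, ∀ x, curl (v (t - τ)) x = curl (v t) x) :
    (∀ t < 0, ∀ x, curl (v t) x = 0) ∨ ∀ s < 0, ∀ t < 0, ∀ y, v s y = v t y := by
  by_cases h0 : ∀ t < 0, ∀ x, curl (v t) x = 0
  · exact Or.inl h0
  · right
    have hper : ∀ τ : ℝ, 0 < τ → ∀ t < 0, ∀ y, v (t - τ) y = v t y := fun τ hτ =>
      (curl_eq_zero_or_periodic_of_curl_periodic v x₀ hB hm hsm hun hτ (hst τ hτ)).resolve_left h0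
    intro s hs t ht y
    rcases lt_trichotomy s t with hlt | heq | hgt
    · have h := hper (t - s) (by linarith) t ht y
      rwa [show t - (t - s) = s by ring] at h
    · rw [heq]
    · have h := hper (s - t) (by linarith) s hs y
      rw [show s - (s - t) = t by ring] at h
      exact h.symm

/-- ★★★ **… HENCE: SLICE-WISE CONSTANT OR EXACTLY STEADY.** [cite: KochNadirashviliSereginSverak2009, Thm 5.2 (arXiv:0709.3599 pp. 9–10)] -/
theorem constant_or_steady_of_curl_steady
    (v : ℝ → EuclideanSpace ℝ (Fin 3) → EuclideanSpace ℝ (Fin 3)) (x₀ : EuclideanSpace ℝ (Fin 3))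
    (hB : Literature.Analysis.FluidPDE.IsBoundedAncientMildSolution 1 v)
    (hm : ∀ t < 0, AEStronglyMeasurable (v t) volume)
    (hsm : ContDiffOn ℝ (⊤ : ℕ∞) (Function.uncurry v) (Set.Iio 0 ×ˢ Set.univ))
    (hun : ∀ t < 0, ∀ x, ⟪x - x₀, curl (v t) x⟫ = 0)
    (hst : ∀ τ : ℝ, 0 < τ → ∀ t < 0, ∀ x, curl (v (t - τ)) x = curl (v t) x) :
    (∀ t < 0, ∃ b : EuclideanSpace ℝ (Fin 3), ∀ x, v t x = b) ∨ ∀ s < 0, ∀ t < 0, ∀ y, v s y = v t y := by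
  rcases curl_eq_zero_or_steady_of_curl_steady v x₀ hB hm hsm hun hst with h | h
  · exact Or.inl (constantOfIrrotational v hB hsm h)
  · exact Or.inr h

/-! ### ★★ Two symmetries with trivial common fixed space ⇒ irrotational or stagnant centre -/

/-- ★★ **TWO SYMMETRIES WITHOUT A COMMON FIXED DIRECTION ⇒ IRROTATIONAL OR STAGNANT CENTRE AT ALL TIMES.**  Under the same hypotheses, if the
vorticity is pseudo-symmetric about `x₀` at every `t < 0` under two linear isometries `R₁`, `R₂` whose common fixed vectors are trivial
(`R₁ w = w → R₂ w = w → w = 0`; e.g. rotations about two distinct axes through `x₀`, or generators of an irreducible polyhedral group), then EITHER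
`curl v ≡ 0` on `(−∞,0) × ℝ³` OR `v(t, x₀) = 0` for every `t < 0`. [cite: KochNadirashviliSereginSverak2009, Thm 5.2 (arXiv:0709.3599 pp. 9–10)] -/
theorem curl_eq_zero_or_centre_stagnant_of_two_symmetries
    (v : ℝ → EuclideanSpace ℝ (Fin 3) → EuclideanSpace ℝ (Fin 3)) (x₀ : EuclideanSpace ℝ (Fin 3))
    (hB : Literature.Analysis.FluidPDE.IsBoundedAncientMildSolution 1 v)
    (hm : ∀ t < 0, AEStronglyMeasurable (v t) volume)
    (hsm : ContDiffOn ℝ (⊤ : ℕ∞) (Function.uncurry v) (Set.Iio 0 ×ˢ Set.univ))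
    (hun : ∀ t < 0, ∀ x, ⟪x - x₀, curl (v t) x⟫ = 0)
    (R₁ R₂ : EuclideanSpace ℝ (Fin 3) ≃ₗᵢ[ℝ] EuclideanSpace ℝ (Fin 3))
    (hfix : ∀ w : EuclideanSpace ℝ (Fin 3), R₁ w = w → R₂ w = w → w = 0)
    (hsym₁ : ∀ t < 0, ∀ y, curl (v t) (x₀ + R₁ y) =
      (R₁ : EuclideanSpace ℝ (Fin 3) →L[ℝ] EuclideanSpace ℝ (Fin 3)).det • R₁ (curl (v t) (x₀ + y)))
    (hsym₂ : ∀ t < 0, ∀ y, curl (v t) (x₀ + R₂ y) =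
      (R₂ : EuclideanSpace ℝ (Fin 3) →L[ℝ] EuclideanSpace ℝ (Fin 3)).det • R₂ (curl (v t) (x₀ + y))) :
    (∀ t < 0, ∀ x, curl (v t) x = 0) ∨ ∀ t < 0, v t x₀ = 0 := by
  rcases curl_eq_zero_or_centre_fixed_of_curl_symmetric v x₀ hB hm hsm hun R₁ hsym₁ with h | h₁
  · exact Or.inl h
  rcases curl_eq_zero_or_centre_fixed_of_curl_symmetric v x₀ hB hm hsm hun R₂ hsym₂ with h | h₂
  · exact Or.inl h
  exact Or.inr fun t ht => hfix (v t x₀) (h₁ t ht) (h₂ t ht)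

/-- ★★ **THE WALL'S LETTER: A POTENTIAL WITH TWO SYMMETRIES WITHOUT A COMMON FIXED DIRECTION ⇒ TRIVIAL OR STAGNANT CENTRE AT ALL TIMES.**
If the vorticity of the wall's flow is `∇T(t,·) × (· − x₀)` with `T(t, x₀ + Rᵢ y) = T(t, x₀ + y)` (`i = 1, 2`) for two linear isometries with
trivial common fixed space, then EITHER `∇T × (x − x₀) ≡ 0` on `(−∞,0) × ℝ³` OR `v(t, x₀) = 0` for every `t < 0`.
[cite: KochNadirashviliSereginSverak2009, Thm 5.2 (arXiv:0709.3599 pp. 9–10)] -/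
theorem stubScalarLiouville_or_centre_stagnant_of_two_symmetric_potential
    (v : ℝ → EuclideanSpace ℝ (Fin 3) → EuclideanSpace ℝ (Fin 3)) (x₀ : EuclideanSpace ℝ (Fin 3))
    (T : ℝ → EuclideanSpace ℝ (Fin 3) → ℝ)
    (hB : Literature.Analysis.FluidPDE.IsBoundedAncientMildSolution 1 v)
    (hm : ∀ t < 0, AEStronglyMeasurable (v t) volume)
    (hsm : ContDiffOn ℝ (⊤ : ℕ∞) (Function.uncurry v) (Set.Iio 0 ×ˢ Set.univ))
    (hrep : ∀ t < 0, ∀ x, Literature.Analysis.FluidPDE.curl (v t) x =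
      Literature.Analysis.FluidPDE.cross (gradient (T t) x) (x - x₀))
    (R₁ R₂ : EuclideanSpace ℝ (Fin 3) ≃ₗᵢ[ℝ] EuclideanSpace ℝ (Fin 3))
    (hfix : ∀ w : EuclideanSpace ℝ (Fin 3), R₁ w = w → R₂ w = w → w = 0)
    (hT₁ : ∀ t < 0, ∀ y, T t (x₀ + R₁ y) = T t (x₀ + y)) (hT₂ : ∀ t < 0, ∀ y, T t (x₀ + R₂ y) = T t (x₀ + y)) :
    (∀ t < 0, ∀ x, Literature.Analysis.FluidPDE.cross (gradient (T t) x) (x - x₀) = 0) ∨ ∀ t < 0, v t x₀ = 0 := by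
  have hun : ∀ t < 0, ∀ x, ⟪x - x₀, curl (v t) x⟫ = 0 := fun t ht x => by
    rw [hrep t ht x]
    simp [cross, crossProduct, PiLp.inner_apply, Fin.sum_univ_three]
    ring
  have hsym₁ : ∀ t < 0, ∀ y, curl (v t) (x₀ + R₁ y) =
      (R₁ : EuclideanSpace ℝ (Fin 3) →L[ℝ] EuclideanSpace ℝ (Fin 3)).det • R₁ (curl (v t) (x₀ + y)) :=
    fun t ht y => curl_symmetric_of_symmetric_potential (hrep t ht) R₁ (hT₁ t ht) y
  have hsym₂ : ∀ t < 0, ∀ y, curl (v t) (x₀ + R₂ y) =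
      (R₂ : EuclideanSpace ℝ (Fin 3) →L[ℝ] EuclideanSpace ℝ (Fin 3)).det • R₂ (curl (v t) (x₀ + y)) :=
    fun t ht y => curl_symmetric_of_symmetric_potential (hrep t ht) R₂ (hT₂ t ht) y
  rcases curl_eq_zero_or_centre_stagnant_of_two_symmetries v x₀ hB hm hsm hun R₁ R₂ hfix hsym₁ hsym₂ with h | h
  · exact Or.inl fun t ht x => by rw [← hrep t ht x]; exact h t ht x
  · exact Or.inr h

/-! ### ★★★ Symmetric vorticity ⇒ irrotational or exactly equivariant velocity -/

/-- ★★★ **PSEUDO-SYMMETRIC VORTICITY ⇒ IRROTATIONAL OR EXACTLY EQUIVARIANT VELOCITY.**  Let `v` be a bounded ancient mild solution (`ν = 1`,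
duality class) with measurable slices, jointly smooth on `(−∞,0) × ℝ³`, unthreaded about `x₀`, whose vorticity is symmetric as a pseudovector
about `x₀` under a linear isometry `R` at every `t < 0`: `curl v(t)(x₀ + R y) = det R • R (curl v(t)(x₀ + y))`.  Then EITHER `curl v ≡ 0` on
`(−∞,0) × ℝ³` OR `v(t, x₀ + R y) = R (v(t, x₀ + y))` for all `t < 0`, `y`: the velocity itself is `R`-equivariant about `x₀` (no drift survives).
[The conjugate twin `u = R v(x₀ + R⁻¹(· − x₀))` has drift `R v(t,x₀) − v(t,x₀)`, which vanishes at all times by the twin dichotomy; twins differ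
exactly by their drift.] [cite: KochNadirashviliSereginSverak2009, Thm 5.2 (arXiv:0709.3599 pp. 9–10)] -/
theorem curl_eq_zero_or_equivariant_of_curl_symmetric
    (v : ℝ → EuclideanSpace ℝ (Fin 3) → EuclideanSpace ℝ (Fin 3)) (x₀ : EuclideanSpace ℝ (Fin 3))
    (hB : Literature.Analysis.FluidPDE.IsBoundedAncientMildSolution 1 v)
    (hm : ∀ t < 0, AEStronglyMeasurable (v t) volume)
    (hsm : ContDiffOn ℝ (⊤ : ℕ∞) (Function.uncurry v) (Set.Iio 0 ×ˢ Set.univ))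
    (hun : ∀ t < 0, ∀ x, ⟪x - x₀, curl (v t) x⟫ = 0)
    (R : EuclideanSpace ℝ (Fin 3) ≃ₗᵢ[ℝ] EuclideanSpace ℝ (Fin 3))
    (hsym : ∀ t < 0, ∀ y, curl (v t) (x₀ + R y) =
      (R : EuclideanSpace ℝ (Fin 3) →L[ℝ] EuclideanSpace ℝ (Fin 3)).det • R (curl (v t) (x₀ + y))) :
    (∀ t < 0, ∀ x, curl (v t) x = 0) ∨ ∀ t < 0, ∀ y, v t (x₀ + R y) = R (v t (x₀ + y)) := by
  rcases curl_eq_zero_or_centre_fixed_of_curl_symmetric v x₀ hB hm hsm hun R hsym with h | hfix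
  · exact Or.inl h
  · right
    have hsm' : IsSmoothSpaceTimeOn (Iio 0) v := hsm
    -- the conjugated twin (as in p814882 / p816196)
    set c : EuclideanSpace ℝ (Fin 3) := x₀ - R.symm x₀ with hc
    set u : ℝ → EuclideanSpace ℝ (Fin 3) → EuclideanSpace ℝ (Fin 3) := fun s y => R (v s (R.symm y + c)) with hu
    have hBu : Literature.Analysis.FluidPDE.IsBoundedAncientMildSolution 1 u := by
      have h := CellFlux.isBoundedAncientMildSolution_frame hB R c (le_refl (0 : ℝ))
      have e : (fun s y => R (v (s + 0) (R.symm y + c))) = u := by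
        funext s y
        rw [add_zero]
      rw [e] at h
      exact h
    have hsmu : ContDiffOn ℝ (⊤ : ℕ∞) (Function.uncurry u) (Set.Iio 0 ×ˢ Set.univ) := by
      have hmap : ContDiff ℝ (⊤ : ℕ∞) fun p : ℝ × EuclideanSpace ℝ (Fin 3) => (p.1, R.symm p.2 + c) :=
        contDiff_fst.prodMk ((R.symm.contDiff.comp contDiff_snd).add contDiff_const)
      have hmaps : MapsTo (fun p : ℝ × EuclideanSpace ℝ (Fin 3) => (p.1, R.symm p.2 + c)) (Iio 0 ×ˢ univ) (Iio 0 ×ˢ univ) :=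
        fun p hp => ⟨hp.1, mem_univ _⟩
      exact R.contDiff.comp_contDiffOn (hsm.comp hmap.contDiffOn hmaps)
    have hcu : ∀ s < 0, ∀ x, curl (u s) x = curl (v s) x := by
      intro s hs x
      rw [hu, curl_conj_rigidMotion R c (v s) x]
      have e1 : R.symm x + c = x₀ + R.symm (x - x₀) := by
        rw [hc, map_sub]
        abel
      rw [e1, ← hsym s hs (R.symm (x - x₀)), LinearIsometryEquiv.apply_symm_apply, add_sub_cancel]
    have hux0 : ∀ s, u s x₀ = R (v s x₀) := by
      intro s
      simp only [hu, hc, add_sub_cancel]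
    intro t ht y
    -- twins differ by their drift, which vanishes
    have h1 := twin_eq_add_drift x₀ hB hsm hBu hsmu hcu t ht (x₀ + R y)
    have h2 : u t x₀ - v t x₀ = 0 := by rw [hux0 t, hfix t ht, sub_self]
    rw [h2, add_zero] at h1
    -- `u t (x₀ + R y) = R (v t (x₀ + y))`
    have h3 : u t (x₀ + R y) = R (v t (x₀ + y)) := by
      simp only [hu, hc, map_add, LinearIsometryEquiv.symm_apply_apply]
      congr 2
      abel
    rw [← h3, h1]

/-- ★★★ **… HENCE: SLICE-WISE CONSTANT OR EXACTLY EQUIVARIANT.** [cite: KochNadirashviliSereginSverak2009, Thm 5.2 (arXiv:0709.3599 pp. 9–10)] -/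
theorem constant_or_equivariant_of_curl_symmetric
    (v : ℝ → EuclideanSpace ℝ (Fin 3) → EuclideanSpace ℝ (Fin 3)) (x₀ : EuclideanSpace ℝ (Fin 3))
    (hB : Literature.Analysis.FluidPDE.IsBoundedAncientMildSolution 1 v)
    (hm : ∀ t < 0, AEStronglyMeasurable (v t) volume)
    (hsm : ContDiffOn ℝ (⊤ : ℕ∞) (Function.uncurry v) (Set.Iio 0 ×ˢ Set.univ))
    (hun : ∀ t < 0, ∀ x, ⟪x - x₀, curl (v t) x⟫ = 0)
    (R : EuclideanSpace ℝ (Fin 3) ≃ₗᵢ[ℝ] EuclideanSpace ℝ (Fin 3))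
    (hsym : ∀ t < 0, ∀ y, curl (v t) (x₀ + R y) =
      (R : EuclideanSpace ℝ (Fin 3) →L[ℝ] EuclideanSpace ℝ (Fin 3)).det • R (curl (v t) (x₀ + y))) :
    (∀ t < 0, ∃ b : EuclideanSpace ℝ (Fin 3), ∀ x, v t x = b) ∨ ∀ t < 0, ∀ y, v t (x₀ + R y) = R (v t (x₀ + y)) := by
  rcases curl_eq_zero_or_equivariant_of_curl_symmetric v x₀ hB hm hsm hun R hsym with h | h
  · exact Or.inl (constantOfIrrotational v hB hsm h)
  · exact Or.inr h

/-- ★★★ **EVEN VORTICITY ⇒ IRROTATIONAL OR EXACTLY ODD (CENTRALLY SYMMETRIC) VELOCITY.**  Under the same hypotheses, if the vorticity is EVEN under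
the point reflection about `x₀` at every `t < 0` (`curl v(t)(x₀ + x₀ − y) = curl v(t)(y)`), then EITHER `curl v ≡ 0` on `(−∞,0) × ℝ³` OR
`v(t, x₀ + x₀ − y) = −v(t, y)` for all `t < 0`, `y`: the even residual of the wall is exactly the NS-invariant centrally symmetric class.
[`reflect_eq_of_curl_even` (velocity odd up to `2 v(t,x₀)`) + the stagnant-centre dichotomy of p816144.]
[cite: KochNadirashviliSereginSverak2009, Thm 5.2 (arXiv:0709.3599 pp. 9–10)] -/
theorem curl_eq_zero_or_odd_of_curl_even
    (v : ℝ → EuclideanSpace ℝ (Fin 3) → EuclideanSpace ℝ (Fin 3)) (x₀ : EuclideanSpace ℝ (Fin 3))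
    (hB : Literature.Analysis.FluidPDE.IsBoundedAncientMildSolution 1 v)
    (hm : ∀ t < 0, AEStronglyMeasurable (v t) volume)
    (hsm : ContDiffOn ℝ (⊤ : ℕ∞) (Function.uncurry v) (Set.Iio 0 ×ˢ Set.univ))
    (hun : ∀ t < 0, ∀ x, ⟪x - x₀, curl (v t) x⟫ = 0)
    (hev : ∀ t < 0, ∀ x, curl (v t) (x₀ + x₀ - x) = curl (v t) x) :
    (∀ t < 0, ∀ x, curl (v t) x = 0) ∨ ∀ t < 0, ∀ y, v t (x₀ + x₀ - y) = -v t y := by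
  rcases curl_eq_zero_or_centre_stagnant_of_curl_even v x₀ hB hm hsm hun hev with h | hst
  · exact Or.inl h
  · right
    have hsm' : IsSmoothSpaceTimeOn (Iio 0) v := hsm
    obtain ⟨M, hM⟩ := hB.isBoundedOn
    intro t ht y
    have hvt : ContDiff ℝ ∞ (v t) := hsm'.contDiff_slice ht
    have hv2 : ContDiff ℝ 2 (v t) := hvt.of_le (by norm_cast)
    have hv1 : ContDiff ℝ 1 (v t) := hvt.of_le (by norm_cast)
    have hdiv : VectorCalculus.IsDivFree (v t) := (hB.isAncientMildSolution.1 t ht).isDivFree_of_contDiff hv1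
    have h := reflect_eq_of_curl_even hv2 hdiv (fun z => hM t ht z) (x₀ + x₀) (hev t ht) y x₀
    rw [add_sub_cancel_right, hst t ht, add_zero] at h
    exact eq_neg_of_add_eq_zero_left h

end Summit.NavierStokesRegularity.NavierStokesRegularity.Theorems.PoloidalLiouville.Antidynamo

end
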